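import Summits.QuantumFields.BalabanUV.T4Continuum.Spine.NE7.QLaBlockAvgFramedStep

/-!
# Spine/NE7/QLaBlockAvgEML — the PRINTED small-loop average `exp[|I|⁻¹ Σ_i log W_i]` of [Balaban1987RG1] (0.4) on `SU(N)`
# (`ExpMeanLog.expMeanLogSU`) TO SECOND ORDER about the identity

Cell `pub-balaban-gaps` (YM blitz Y1, track G2, seat `ne7`, generation 8); text of record
`run/shared/lean/pub/pub-balaban-gaps/ne/NE7.md` v8 §4nonies, census rows R52–R54.  Twenty-sixth `Spine/NE7/` file; second of the
four files `QLaBlockAvgFramedStep` ∕ `QLaBlockAvgEML` ∕ `QLaBlockAvgLinear` ∕ `QLaBlockAvgContraction` of generation 8 (see the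
first for WHY: NODE S's holonomy-level input for the headline's printed class `IsPrintedAveraged₁`).

WHAT IS PROVED ([folklore] bookkeeping over the tree's `MatrixLog` ∕ `ExpMeanLog` ∕ `B7Prop1Explicit`, kernel-checked, 0 sorry):
* `coe_avg_expMeanLogSU`: on a family within the radius `δ_N = min(1/3, π/N)` of the identity the tree's re-indexed average
  `expMeanLogSU.avg W` IS the printed `exp[|I|⁻¹ Σ_i log W_i]` (the `LoopAverage.enum` re-indexing undone);
* `norm_avg_sub_one_sub_mean_le`: for `dist1 W_i ≤ η ≤ ½`, `η < δ_N`:  `‖E(W) − 1 − |I|⁻¹ Σ_i (W_i − 1)‖ ≤ 8η · |I|⁻¹ Σ_i dist1 W_i`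
  — from [Balaban1985Averaging] p. 22 (26) `|log X| ≤ 2|X − 1|` and (27) `|X − 1| ≤ e^{|log X|} − 1`, whence
  `|log X − (X − 1)| ≤ ρ(2|X − 1|)`, `ρ(t) = e^t − 1 − t` (tree `MatrixLog.norm_mlog_le_two_mul`, `B7Prop1Explicit.norm_mlog_sub_le`), and
  `|e^Y − 1 − Y| ≤ ρ(|Y|) ≤ |Y|²` for the exponent;
* `norm_avg_sub_one_le`: to first order, `‖E(W) − 1‖ ≤ 5 · |I|⁻¹ Σ_i dist1 W_i`.
These are the two facts about the inner operation of (0.4) that the one-step second-order analysis of `QLaBlockAvgContraction` uses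
(for the correction factor `corr` of `BlockAveraging.blockAvg` AND for the frames, which are `expMeanLogSU`-averages of staircase
transporters).

HONEST FRAMING.  Elementary estimates on the printed operation; nothing of Bałaban's Propositions is asserted; (QL-a) NOT IN PRINT
([Balaban1989LargeFieldII] p. 356); NE7 NOT proved; spine 0∕9; fixed finite T⁴ — NOT ℝ⁴, NOT infinite volume, NOT a mass gap, NOT Clay.
-/

noncomputable section

open Finset
open scoped BigOperators Matrix Matrix.Norms.L2Operator

namespace Summit.QuantumFields.BalabanUV.T4Continuum.Spine.NE7

open Literature.MathematicalPhysics.QuantumFieldTheory.Balaban1983to89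
open Literature.MathematicalPhysics.QuantumFieldTheory.Balaban1983to89.T4Continuum

section SUN

open ExpMeanLog MatrixLog B7Prop1Explicit

variable {n : Type*} [Fintype n] [DecidableEq n] [Nonempty n]

/-! ### The printed small-loop average `expMeanLogSU` to second order -/

/-- On a family within the radius `δ_N` of the identity, the tree's re-indexed average `expMeanLogSU.avg W` IS the printed
`exp[|I|⁻¹ Σ_i log W_i]` of the family (`ExpMeanLog.eml`; the re-indexing through `LoopAverage.enum` is undone by reindexing the
finite sum). [cite: Balaban1987RG1, (0.4) p.253] -/
theorem coe_avg_expMeanLogSU {ι : Type*} [Fintype ι] [Nonempty ι] (W : ι → Matrix.specialUnitaryGroup n ℂ)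
    (hW : ∀ i, dist1 (W i) < deltaSU n) :
    (((expMeanLogSU (n := n)).avg W : Matrix.specialUnitaryGroup n ℂ) : MatA n)
      = NormedSpace.exp (((Fintype.card ι : ℂ))⁻¹ • ∑ i, mlog ((W i : Matrix.specialUnitaryGroup n ℂ) : MatA n)) := by
  unfold LoopAverage.avg
  have hW' : ∀ k, ‖(((W ∘ ⇑(LoopAverage.enum ι).symm) k : Matrix.specialUnitaryGroup n ℂ) : MatA n) - 1‖ < deltaSU n :=
    fun k => by rw [← dist1_eq_norm]; exact hW _
  rw [show (expMeanLogSU (n := n)).E (W ∘ ⇑(LoopAverage.enum ι).symm) = ESU (W ∘ ⇑(LoopAverage.enum ι).symm) from rfl,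
    coe_ESU_of_small hW', eml_eq_exp]
  congr 1
  rw [← Fintype.card_congr (LoopAverage.enum ι)]
  congr 1
  exact Equiv.sum_comp (LoopAverage.enum ι).symm (fun i => mlog ((W i : Matrix.specialUnitaryGroup n ℂ) : MatA n))

omit [DecidableEq n] [Nonempty n] in
/-- A mean of reals bounded by `η` termwise is bounded by `η`. [folklore] -/
theorem mean_le_of_le {ι : Type*} [Fintype ι] [Nonempty ι] {a : ι → ℝ} {η : ℝ} (h : ∀ i, a i ≤ η) :
    (Fintype.card ι : ℝ)⁻¹ * ∑ i, a i ≤ η := by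
  have hc : (0 : ℝ) < Fintype.card ι := Nat.cast_pos.mpr Fintype.card_pos
  rw [inv_mul_le_iff₀ hc]
  calc ∑ i, a i ≤ ∑ _i : ι, η := Finset.sum_le_sum fun i _ => h i
    _ = Fintype.card ι * η := by rw [Finset.sum_const, Finset.card_univ, nsmul_eq_mul]

omit [Nonempty n] in
/-- The norm of a `|I|⁻¹`-weighted sum is at most the mean of the norms. [folklore] -/
theorem norm_mean_le {ι : Type*} [Fintype ι] [Nonempty ι] (m : ι → MatA n) :
    ‖((Fintype.card ι : ℂ))⁻¹ • ∑ i, m i‖ ≤ (Fintype.card ι : ℝ)⁻¹ * ∑ i, ‖m i‖ := by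
  rw [norm_smul, norm_inv, Complex.norm_natCast]
  exact mul_le_mul_of_nonneg_left (norm_sum_le _ _) (inv_nonneg.mpr (Nat.cast_nonneg _))

/-- **THE PRINTED SMALL-LOOP AVERAGE TO SECOND ORDER**: for a family `W` in `SU(N)` with all `dist1 W_i ≤ η`, `η ≤ ½`, `η < δ_N`,
`‖E(W) − 1 − |I|⁻¹ Σ_i (W_i − 1)‖ ≤ 8η · |I|⁻¹ Σ_i dist1 W_i` — from [Balaban1985Averaging] p. 22 (26) `|log X| ≤ 2|X − 1|`
(`|X − 1| ≤ ½`) and (27) `|X − 1| ≤ e^{|log X|} − 1`, whence `|log X − (X − 1)| ≤ ρ(2|X − 1|)` (tree: `MatrixLog.norm_mlog_le_two_mul`,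
`B7Prop1Explicit.norm_mlog_sub_le`), and `|e^Y − 1 − Y| ≤ ρ(|Y|) ≤ |Y|²` for the exponent `Y = mean log W_i`, `|Y| ≤ 2η ≤ 1`.
[cite: Balaban1985Averaging, (26)–(27) p.22] -/
theorem norm_avg_sub_one_sub_mean_le {ι : Type*} [Fintype ι] [Nonempty ι] (W : ι → Matrix.specialUnitaryGroup n ℂ) {η : ℝ}
    (hηδ : η < deltaSU n) (hη : η ≤ 1 / 2) (hW : ∀ i, dist1 (W i) ≤ η) :
    ‖(((expMeanLogSU (n := n)).avg W : Matrix.specialUnitaryGroup n ℂ) : MatA n) - 1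
        - ((Fintype.card ι : ℂ))⁻¹ • ∑ i, (((W i : Matrix.specialUnitaryGroup n ℂ) : MatA n) - 1)‖
      ≤ 8 * η * ((Fintype.card ι : ℝ)⁻¹ * ∑ i, dist1 (W i)) := by
  have hWlt : ∀ i, dist1 (W i) < deltaSU n := fun i => (hW i).trans_lt hηδ
  rw [coe_avg_expMeanLogSU W hWlt]
  set c : ℝ := (Fintype.card ι : ℝ)⁻¹ with hc
  set a : ι → ℝ := fun i => dist1 (W i) with ha
  set abar : ℝ := c * ∑ i, a i with habar
  set Y : MatA n := ((Fintype.card ι : ℂ))⁻¹ • ∑ i, mlog ((W i : Matrix.specialUnitaryGroup n ℂ) : MatA n) with hY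
  set Lm : MatA n := ((Fintype.card ι : ℂ))⁻¹ • ∑ i, (((W i : Matrix.specialUnitaryGroup n ℂ) : MatA n) - 1) with hLm
  have ha0 : ∀ i, 0 ≤ a i := fun i => GaugeGroup.dist1_nonneg _
  have hc0 : 0 ≤ c := inv_nonneg.mpr (Nat.cast_nonneg _)
  have habar0 : 0 ≤ abar := mul_nonneg hc0 (Finset.sum_nonneg fun i _ => ha0 i)
  have habarη : abar ≤ η := mean_le_of_le hW
  have hη0 : 0 ≤ η := (ha0 (Classical.arbitrary ι)).trans (hW _)
  -- the exponent: ‖Y‖ ≤ 2·abar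
  have hlog : ∀ i, ‖mlog ((W i : Matrix.specialUnitaryGroup n ℂ) : MatA n)‖ ≤ 2 * a i := fun i =>
    norm_mlog_le_two_mul (by rw [← dist1_eq_norm]; exact (hW i).trans hη)
  have hYn : ‖Y‖ ≤ 2 * abar := by
    refine (norm_mean_le _).trans ?_
    rw [habar, hc, mul_comm 2, mul_assoc, Finset.sum_mul]
    refine mul_le_mul_of_nonneg_left (Finset.sum_le_sum fun i _ => ?_) hc0
    rw [mul_comm]; exact hlog i
  have hY1 : ‖Y‖ ≤ 1 := hYn.trans (by linarith)
  -- `e^Y − 1 − Y`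
  have hexp : ‖NormedSpace.exp Y - 1 - Y‖ ≤ 4 * η * abar := by
    have h1 := (norm_exp_sub_one_le_of_norm_le (le_refl ‖Y‖)).2
    have h2 := expRem_le_sq (norm_nonneg Y) hY1
    calc ‖NormedSpace.exp Y - 1 - Y‖ ≤ ‖Y‖ ^ 2 := h1.trans h2
      _ ≤ (2 * abar) * (2 * η) := by
          rw [pow_two]; exact mul_le_mul hYn (hYn.trans (by linarith)) (norm_nonneg _) (by linarith)
      _ = 4 * η * abar := by ring
  -- `Y − mean (W − 1)`
  have hlin : ‖Y - Lm‖ ≤ 4 * η * abar := by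
    have hdiff : Y - Lm = ((Fintype.card ι : ℂ))⁻¹ •
        ∑ i, (mlog ((W i : Matrix.specialUnitaryGroup n ℂ) : MatA n) - ((((W i : Matrix.specialUnitaryGroup n ℂ)) : MatA n) - 1)) := by
      rw [hY, hLm, ← smul_sub, ← Finset.sum_sub_distrib]
    rw [hdiff]
    refine (norm_mean_le _).trans ?_
    have hterm : ∀ i, ‖mlog ((W i : Matrix.specialUnitaryGroup n ℂ) : MatA n) - ((((W i : Matrix.specialUnitaryGroup n ℂ)) : MatA n) - 1)‖
        ≤ 4 * η * a i := fun i => by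
      have hsm : ‖((W i : Matrix.specialUnitaryGroup n ℂ) : MatA n) - 1‖ ≤ 1 / 2 := by rw [← dist1_eq_norm]; exact (hW i).trans hη
      refine (norm_mlog_sub_le hsm).trans ?_
      rw [← dist1_eq_norm]
      have h2a : 2 * a i ≤ 1 := by have := hW i; show 2 * dist1 (W i) ≤ 1; linarith
      refine (expRem_le_sq (mul_nonneg zero_le_two (ha0 i)) h2a).trans ?_
      have := hW i
      nlinarith [ha0 i]
    calc (Fintype.card ι : ℝ)⁻¹ * ∑ i, ‖mlog ((W i : Matrix.specialUnitaryGroup n ℂ) : MatA n)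
            - ((((W i : Matrix.specialUnitaryGroup n ℂ)) : MatA n) - 1)‖
        ≤ c * ∑ i, 4 * η * a i := mul_le_mul_of_nonneg_left (Finset.sum_le_sum fun i _ => hterm i) hc0
      _ = 4 * η * abar := by rw [habar, ← Finset.mul_sum]; ring
  have hsplit : NormedSpace.exp Y - 1 - Lm = (NormedSpace.exp Y - 1 - Y) + (Y - Lm) := by abel
  rw [hsplit]
  calc ‖(NormedSpace.exp Y - 1 - Y) + (Y - Lm)‖ ≤ 4 * η * abar + 4 * η * abar := (norm_add_le _ _).trans (add_le_add hexp hlin)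
    _ = 8 * η * abar := by ring

/-- … and to FIRST order: `‖E(W) − 1‖ ≤ 5 · |I|⁻¹ Σ_i dist1 W_i` (`≤ 5η`). [folklore] -/
theorem norm_avg_sub_one_le {ι : Type*} [Fintype ι] [Nonempty ι] (W : ι → Matrix.specialUnitaryGroup n ℂ) {η : ℝ}
    (hηδ : η < deltaSU n) (hη : η ≤ 1 / 2) (hW : ∀ i, dist1 (W i) ≤ η) :
    ‖(((expMeanLogSU (n := n)).avg W : Matrix.specialUnitaryGroup n ℂ) : MatA n) - 1‖
      ≤ 5 * ((Fintype.card ι : ℝ)⁻¹ * ∑ i, dist1 (W i)) := by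
  have h2 := norm_avg_sub_one_sub_mean_le W hηδ hη hW
  have hη0 : 0 ≤ η := (GaugeGroup.dist1_nonneg _).trans (hW (Classical.arbitrary ι))
  set E : MatA n := (((expMeanLogSU (n := n)).avg W : Matrix.specialUnitaryGroup n ℂ) : MatA n)
  set Lm : MatA n := ((Fintype.card ι : ℂ))⁻¹ • ∑ i, (((W i : Matrix.specialUnitaryGroup n ℂ) : MatA n) - 1)
  have hLm : ‖Lm‖ ≤ (Fintype.card ι : ℝ)⁻¹ * ∑ i, dist1 (W i) := by
    refine (norm_mean_le _).trans (le_of_eq ?_)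
    simp_rw [dist1_eq_norm]
  have hm0 : 0 ≤ (Fintype.card ι : ℝ)⁻¹ * ∑ i, dist1 (W i) :=
    mul_nonneg (inv_nonneg.mpr (Nat.cast_nonneg _)) (Finset.sum_nonneg fun i _ => GaugeGroup.dist1_nonneg _)
  have hsplit : E - 1 = (E - 1 - Lm) + Lm := by abel
  rw [hsplit]
  calc ‖(E - 1 - Lm) + Lm‖ ≤ 8 * η * ((Fintype.card ι : ℝ)⁻¹ * ∑ i, dist1 (W i)) + (Fintype.card ι : ℝ)⁻¹ * ∑ i, dist1 (W i) :=
        (norm_add_le _ _).trans (add_le_add h2 hLm)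
    _ ≤ 5 * ((Fintype.card ι : ℝ)⁻¹ * ∑ i, dist1 (W i)) := by
        have : 8 * η * ((Fintype.card ι : ℝ)⁻¹ * ∑ i, dist1 (W i)) ≤ 4 * ((Fintype.card ι : ℝ)⁻¹ * ∑ i, dist1 (W i)) := by
          nlinarith
        linarith

end SUN

end Summit.QuantumFields.BalabanUV.T4Continuum.Spine.NE7

end
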